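import Summits.CriticalPhenomena.PercolationContinuityZ3.Theorems.PercNearOneGluingNoHeavyLowerTailCubicThreePointFibreThetaHqt
import Summits.CriticalPhenomena.PercolationContinuityZ3.Theorems.PercNearOneGluingNoHeavyLowerTailCubicFourPointL1Step
import Summits.CriticalPhenomena.PercolationContinuityZ3.Theorems.PercNearOneGluingNoHeavyLowerTailCubicThreePointGluingPendantCells
import Summits.CriticalPhenomena.PercolationContinuityZ3.Theorems.PercNearOneGluingNoHeavyLowerTailCubicThreePointGluingJoinCells
import Mathlib.Tactic.Ring
import Mathlib.Tactic.Linarith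
import HarnessLib

/-!
# `NoHeavyLowerTail` (stmt-CriticalPhenomena-4575) — explicit three-point cells of small systems: single edges, terminal chords,
# doubled arms, and the STAR LAW of a hub with single-edge arms (graph level, `PrW` calculus)

Support file (prover prim-gen-kcluster gen 24, k-cluster / sharp-cubic-row line; `--supports stmt-CriticalPhenomena-4575`).  No definitions,
no named facts, no sorries.  In the finitary weighted-cube calculus of `…CubicThreePointSections` (random edges `D`, forced edges `K`,
cells `evQ/evU₁/evU₂/evU₃/evT` = `a|b|c, ab|c, ac|b, bc|a, abc`, masses `PrW D p ·`) this file computes CELL VALUES (not merely class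
membership as in prim-sahi-p2's `SPLaw`/`TSP` files) for the building blocks of the hub-edge graph `Θ = K_{2,3} + e`:
* tools: `PrW_not` (complement), `PrW_single_mem` (`PrW {e} {e open} = p_e`), `PrW_pair_or` (a doubled arm:
  `p_e + p_{e'} − p_e p_{e'}`), `ind_eq_mul_of_iff`, `mem_union_iff_left/right` (reading a coordinate off one block);
* a single edge `{a,b}` seen from `(a,b,c)`: law `(1 − x, x, 0, 0, 0)` (`single_Q/U₁/U₂/U₃/T`, `single_armT`);
* exchanging the last two terminals (`evQ/evT/evU₁/evU₂/evU₃_swap23`);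
* (reused, not restated: prim-bnk-1's chord-insertion cells `TerminalGluing.PrW_insert_ab_ev*` of `…FibreThetaHqt` and `CubicFourPointL1.PrW_empty`);
* two arms `{h,b},{h,c}` seen from `(h,b,c)` (`twoArms_*`) and the **STAR LAW** of a hub `h` with single-edge arms of probabilities `x, y, z`
  to `a, b, c` (`star_Q/U₁/U₂/U₃/T`): `(1 − (xy+xz+yz) + 2xyz, xy(1−z), xz(1−y), yz(1−x), xyz)`, via the pendant formulas `PrW_pendant_*`
  (`…GluingPendantCells`).
Consumed by `…CubicThreePointThetaCells` (the cells of `K_{2,3}`, of the merged star and of `Θ` on `Fin 5`) and `…CubicThreePointSharpRowFiveVertices`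
(the sharp dichotomy `max(Ha,Hb) ≥ 0` for every weighted graph on five vertices).
[cite: Gladkov2024StrongFKG, Cor. 4.2 (the three-point cells)]; [cite: Grimmett1999, §2.2 (product measure on configurations)]
-/

noncomputable section

namespace Summit.CriticalPhenomena.PercolationContinuityZ3.Theorems

namespace ThetaCells

open Finset SimpleGraph Literature.Probability.Percolation Literature.Probability.Percolation.DecisionTree
open CubicThreePointStep CubicThreePointTerminal TerminalGluing

variable {V : Type*} [DecidableEq V]

/-! ### The empty system and a single edge -/

/-- With no open and no forced edges, distinct vertices are not joined. [folklore] -/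
theorem not_R_empty {x y : V} (h : x ≠ y) : ¬ R (∅ : Finset (Sym2 V)) ∅ x y := fun hR =>
  h (eq_of_R_of_avoids (K := ∅) (D := ∅) (Finset.empty_subset _) (fun e he => by simp at he) hR)

/-- With the single edge `{x,y}` forced and nothing open, a third vertex `z` is joined only to itself. [folklore] -/
theorem not_R_forced_single {x y z w : V} (hzx : z ≠ x) (hzy : z ≠ y) (hzw : z ≠ w) :
    ¬ R (insert s(x, y) (∅ : Finset (Sym2 V))) ∅ z w := fun hR =>
  hzw (eq_of_R_of_avoids (K := insert s(x, y) ∅) (D := ∅) (Finset.empty_subset _)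
    (fun e he => by
      simp only [Finset.empty_union, Finset.mem_insert, Finset.notMem_empty, or_false] at he
      subst he
      rw [Sym2.mem_iff, not_or]; exact ⟨hzx, hzy⟩) hR)

section SingleEdge

variable (p : Sym2 V → ℝ) {a b c : V}

/-- The arm law: `P(a ↔ h) = p_{ah}` for the single edge `{a,h}`. [folklore] -/
theorem single_armT (hab : a ≠ b) : PrW ({s(a, b)} : Finset (Sym2 V)) p (evT ∅ a b b) = p s(a, b) := by
  rw [← Finset.insert_empty, PrW_split ∅ p (Finset.notMem_empty _), sect_evT, CubicFourPointL1.PrW_empty, CubicFourPointL1.PrW_empty,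
    ind_of_not_mem (fun h => not_R_empty hab (mem_evT.1 h).1),
    ind_of_mem (mem_evT.2 ⟨R_insert_edge hab, R_insert_edge hab⟩)]
  ring

/-- The third terminal lies on no edge of the single-edge system `{a,b}`. [folklore] -/
theorem single_avoids (hca : c ≠ a) (hcb : c ≠ b) : ∀ e ∈ ({s(a, b)} : Finset (Sym2 V)) ∪ ∅, c ∉ e := by
  intro e he
  simp only [Finset.union_empty, Finset.mem_singleton] at he
  subst he
  rw [Sym2.mem_iff, not_or]; exact ⟨hca, hcb⟩

/-- Single edge `{a,b}`, terminals `(a,b,c)`: `u₁ = P(ab|c) = p_{ab}`. [folklore] -/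
theorem single_U₁ (hab : a ≠ b) (hca : c ≠ a) (hcb : c ≠ b) :
    PrW ({s(a, b)} : Finset (Sym2 V)) p (evU₁ ∅ a b c) = p s(a, b) := by
  rw [← Finset.insert_empty, PrW_split ∅ p (Finset.notMem_empty _), sect_evU₁, CubicFourPointL1.PrW_empty, CubicFourPointL1.PrW_empty,
    ind_of_not_mem (fun h => not_R_empty hab (mem_evU₁.1 h).1),
    ind_of_mem (mem_evU₁.2 ⟨R_insert_edge hab, fun h => not_R_forced_single hca hcb hca h.symm⟩)]
  ring

/-- Single edge `{a,b}`: `u₂ = 0`. [folklore] -/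
theorem single_U₂ (hca : c ≠ a) (hcb : c ≠ b) : PrW ({s(a, b)} : Finset (Sym2 V)) p (evU₂ ∅ a b c) = 0 :=
  PrW_chord_U₂ _ p (single_avoids hca hcb) hca.symm

/-- Single edge `{a,b}`: `u₃ = 0`. [folklore] -/
theorem single_U₃ (hca : c ≠ a) (hcb : c ≠ b) : PrW ({s(a, b)} : Finset (Sym2 V)) p (evU₃ ∅ a b c) = 0 :=
  PrW_chord_U₃ _ p (single_avoids hca hcb) hcb.symm

/-- Single edge `{a,b}`: `t = 0`. [folklore] -/
theorem single_T (hca : c ≠ a) (hcb : c ≠ b) : PrW ({s(a, b)} : Finset (Sym2 V)) p (evT ∅ a b c) = 0 :=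
  PrW_chord_T _ p (single_avoids hca hcb) hca.symm

/-- Single edge `{a,b}`: `q = 1 − p_{ab}`. [folklore] -/
theorem single_Q (hab : a ≠ b) (hca : c ≠ a) (hcb : c ≠ b) :
    PrW ({s(a, b)} : Finset (Sym2 V)) p (evQ ∅ a b c) = 1 - p s(a, b) := by
  rw [PrW_chord_Q _ p (single_avoids hca hcb) hca.symm hcb.symm, single_U₁ p hab hca hcb]

end SingleEdge

/-! ### Exchanging the last two terminals -/

section Swap23

variable (K : Finset (Sym2 V)) (a b c : V)

/-- `abc` is symmetric in `b, c`. [folklore] -/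
theorem evT_swap23 : evT K a c b = evT K a b c := by
  ext S; simp only [mem_evT]; exact And.comm

/-- `a|b|c` is symmetric in `b, c`. [folklore] -/
theorem evQ_swap23 : evQ K a c b = evQ K a b c := by
  ext S; simp only [mem_evQ]
  constructor
  · rintro ⟨h1, h2, h3⟩; exact ⟨h2, h1, fun h => h3 h.symm⟩
  · rintro ⟨h1, h2, h3⟩; exact ⟨h2, h1, fun h => h3 h.symm⟩

/-- Exchanging `b, c` turns `ab|c` into `ac|b` (definitionally). [folklore] -/
theorem evU₁_swap23 : evU₁ K a c b = evU₂ K a b c := rfl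

/-- Exchanging `b, c` turns `ac|b` into `ab|c` (definitionally). [folklore] -/
theorem evU₂_swap23 : evU₂ K a c b = evU₁ K a b c := rfl

/-- `bc|a` is symmetric in `b, c`. [folklore] -/
theorem evU₃_swap23 : evU₃ K a c b = evU₃ K a b c := by
  ext S; simp only [mem_evU₃]
  constructor
  · rintro ⟨h1, h2⟩; exact ⟨h1.symm, fun h => h2 (h.trans h1.symm)⟩
  · rintro ⟨h1, h2⟩; exact ⟨h1.symm, fun h => h2 (h.trans h1.symm)⟩

end Swap23

/-! ### A hub: one Steiner vertex `h` with single-edge arms to the three terminals (the star law) -/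

omit [DecidableEq V] in
/-- Distinct arms are distinct edges: `{h,b} ≠ {h,c}`. [folklore] -/
theorem arm_ne {b c h : V} (hbc : b ≠ c) (hbh : b ≠ h) : s(h, b) ≠ s(h, c) := by
  rw [Ne, Sym2.eq_iff]
  rintro (⟨_, h'⟩ | ⟨_, h'⟩)
  · exact hbc h'
  · exact hbh h'

section TwoArms

variable (p : Sym2 V → ℝ) {b c h : V} (hbc : b ≠ c) (hbh : b ≠ h) (hch : c ≠ h)
include hbc hbh hch

/-- The two arms `{h,b}, {h,c}` seen from `(h, b, c)`: `t = yz`. [folklore] -/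
theorem twoArms_T : PrW ({s(h, b), s(h, c)} : Finset (Sym2 V)) p (evT ∅ h b c) = p s(h, b) * p s(h, c) := by
  rw [show ({s(h, b), s(h, c)} : Finset (Sym2 V)) = insert s(h, b) {s(h, c)} from rfl,
    PrW_insert_ab_evT _ p ∅ c hbh.symm (fun hm => arm_ne hbc hbh (Finset.mem_singleton.1 hm)), evT_swap23 ∅ h c b,
    evU₂_swap23 ∅ h c b, evU₃_swap23 ∅ h c b, single_T p hbh hbc, single_U₁ p hch.symm hbh hbc, single_U₃ p hbh hbc]
  ring

/-- The two arms seen from `(h, b, c)`: `u₁ = y(1−z)`. [folklore] -/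
theorem twoArms_U₁ : PrW ({s(h, b), s(h, c)} : Finset (Sym2 V)) p (evU₁ ∅ h b c) = p s(h, b) * (1 - p s(h, c)) := by
  rw [show ({s(h, b), s(h, c)} : Finset (Sym2 V)) = insert s(h, b) {s(h, c)} from rfl,
    PrW_insert_ab_evU₁ _ p ∅ c hbh.symm (fun hm => arm_ne hbc hbh (Finset.mem_singleton.1 hm)), evU₁_swap23 ∅ h c b,
    evQ_swap23 ∅ h c b, single_U₂ p hbh hbc, single_Q p hch.symm hbh hbc]
  ring

/-- The two arms seen from `(h, b, c)`: `u₂ = (1−y)z`. [folklore] -/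
theorem twoArms_U₂ : PrW ({s(h, b), s(h, c)} : Finset (Sym2 V)) p (evU₂ ∅ h b c) = (1 - p s(h, b)) * p s(h, c) := by
  rw [show ({s(h, b), s(h, c)} : Finset (Sym2 V)) = insert s(h, b) {s(h, c)} from rfl,
    PrW_insert_ab_evU₂ _ p ∅ c hbh.symm (fun hm => arm_ne hbc hbh (Finset.mem_singleton.1 hm)), evU₂_swap23 ∅ h c b,
    single_U₁ p hch.symm hbh hbc]

omit hch in
/-- The two arms seen from `(h, b, c)`: `u₃ = 0`. [folklore] -/
theorem twoArms_U₃ : PrW ({s(h, b), s(h, c)} : Finset (Sym2 V)) p (evU₃ ∅ h b c) = 0 := by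
  rw [show ({s(h, b), s(h, c)} : Finset (Sym2 V)) = insert s(h, b) {s(h, c)} from rfl,
    PrW_insert_ab_evU₃ _ p ∅ c hbh.symm (fun hm => arm_ne hbc hbh (Finset.mem_singleton.1 hm)), evU₃_swap23 ∅ h c b,
    single_U₃ p hbh hbc, mul_zero]

/-- The two arms seen from `(h, b, c)`: `q = (1−y)(1−z)`. [folklore] -/
theorem twoArms_Q : PrW ({s(h, b), s(h, c)} : Finset (Sym2 V)) p (evQ ∅ h b c) = (1 - p s(h, b)) * (1 - p s(h, c)) := by
  rw [show ({s(h, b), s(h, c)} : Finset (Sym2 V)) = insert s(h, b) {s(h, c)} from rfl,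
    PrW_insert_ab_evQ _ p ∅ c hbh.symm (fun hm => arm_ne hbc hbh (Finset.mem_singleton.1 hm)), evQ_swap23 ∅ h c b,
    single_Q p hch.symm hbh hbc]

end TwoArms

/-! ### A hub: one Steiner vertex `h` with single-edge arms to the three terminals (the star law) -/

section Star

variable (p : Sym2 V → ℝ) {a b c h : V}

/-- The arm at `a` is disjoint from the two other arms. [folklore] -/
theorem star_disj (hab : a ≠ b) (hac : a ≠ c) (hah : a ≠ h) :
    Disjoint ({s(a, h)} : Finset (Sym2 V)) {s(h, b), s(h, c)} := by
  rw [Finset.disjoint_singleton_left, Finset.mem_insert, Finset.mem_singleton, not_or, Sym2.eq_iff, Sym2.eq_iff]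
  exact ⟨fun h' => h'.elim (fun q => hah q.1) (fun q => hab q.1), fun h' => h'.elim (fun q => hah q.1) (fun q => hac q.1)⟩

/-- The arm at `a` meets the two other arms only in the hub `h`. [folklore] -/
theorem star_sep (hab : a ≠ b) (hac : a ≠ c) :
    ∀ v : V, ∀ e₁ ∈ ({s(a, h)} : Finset (Sym2 V)) ∪ ∅, ∀ e₂ ∈ ({s(h, b), s(h, c)} : Finset (Sym2 V)) ∪ ∅,
      v ∈ e₁ → v ∈ e₂ → v = h := by
  intro v e₁ he₁ e₂ he₂ hv₁ hv₂
  simp only [Finset.union_empty, Finset.mem_singleton, Finset.mem_insert] at he₁ he₂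
  subst he₁
  rw [Sym2.mem_iff] at hv₁
  rcases hv₁ with rfl | rfl
  · rcases he₂ with rfl | rfl
    · rw [Sym2.mem_iff] at hv₂
      exact hv₂.elim id (fun h' => absurd h' hab)
    · rw [Sym2.mem_iff] at hv₂
      exact hv₂.elim id (fun h' => absurd h' hac)
  · rfl

/-- `a` lies on neither of the other two arms. [folklore] -/
theorem star_avoids (hab : a ≠ b) (hac : a ≠ c) (hah : a ≠ h) :
    ∀ e ∈ ({s(h, b), s(h, c)} : Finset (Sym2 V)) ∪ ∅, a ∉ e := by
  intro e he
  simp only [Finset.union_empty, Finset.mem_singleton, Finset.mem_insert] at he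
  rcases he with rfl | rfl <;> rw [Sym2.mem_iff, not_or]
  · exact ⟨hah, hab⟩
  · exact ⟨hah, hac⟩

variable (hab : a ≠ b) (hac : a ≠ c) (hbc : b ≠ c) (hah : a ≠ h) (hbh : b ≠ h) (hch : c ≠ h)
include hab hac hbc hah hbh hch

/-- **Star law, `t = P(abc) = xyz`** (`x, y, z` the arm probabilities). [folklore] -/
theorem star_T : PrW ({s(a, h), s(h, b), s(h, c)} : Finset (Sym2 V)) p (evT ∅ a b c) =
    p s(a, h) * p s(h, b) * p s(h, c) := by
  have e := PrW_pendant_T p (star_disj hab hac hah) (star_sep hab hac) (star_avoids hab hac hah)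
    (single_avoids hab.symm hbh) (single_avoids hac.symm hch) hab hac
  rw [Finset.empty_union, ← Finset.insert_eq] at e
  rw [e, single_armT p hah, twoArms_T p hbc hbh hch, mul_assoc]

/-- **Star law, `u₁ = P(ab|c) = xy(1−z)`.** [folklore] -/
theorem star_U₁ : PrW ({s(a, h), s(h, b), s(h, c)} : Finset (Sym2 V)) p (evU₁ ∅ a b c) =
    p s(a, h) * p s(h, b) * (1 - p s(h, c)) := by
  have e := PrW_pendant_U₁ p (star_disj hab hac hah) (star_sep hab hac) (star_avoids hab hac hah)
    (single_avoids hab.symm hbh) (single_avoids hac.symm hch) hab hac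
  rw [Finset.empty_union, ← Finset.insert_eq] at e
  rw [e, single_armT p hah, twoArms_U₁ p hbc hbh hch, mul_assoc]

/-- **Star law, `u₂ = P(ac|b) = xz(1−y)`.** [folklore] -/
theorem star_U₂ : PrW ({s(a, h), s(h, b), s(h, c)} : Finset (Sym2 V)) p (evU₂ ∅ a b c) =
    p s(a, h) * p s(h, c) * (1 - p s(h, b)) := by
  have e := PrW_pendant_U₂ p (star_disj hab hac hah) (star_sep hab hac) (star_avoids hab hac hah)
    (single_avoids hab.symm hbh) (single_avoids hac.symm hch) hab hac
  rw [Finset.empty_union, ← Finset.insert_eq] at e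
  rw [e, single_armT p hah, twoArms_U₂ p hbc hbh hch]; ring

/-- **Star law, `u₃ = P(bc|a) = yz(1−x)`.** [folklore] -/
theorem star_U₃ : PrW ({s(a, h), s(h, b), s(h, c)} : Finset (Sym2 V)) p (evU₃ ∅ a b c) =
    p s(h, b) * p s(h, c) * (1 - p s(a, h)) := by
  have e := PrW_pendant_U₃ p (star_disj hab hac hah) (star_sep hab hac) (star_avoids hab hac hah)
    (single_avoids hab.symm hbh) (single_avoids hac.symm hch) hab
  rw [Finset.empty_union, ← Finset.insert_eq] at e
  rw [e, single_armT p hah, twoArms_U₃ p hbc hbh, twoArms_T p hbc hbh hch]; ring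

/-- **Star law, `q = P(a|b|c) = 1 − (xy+xz+yz) + 2xyz`.** [folklore] -/
theorem star_Q : PrW ({s(a, h), s(h, b), s(h, c)} : Finset (Sym2 V)) p (evQ ∅ a b c) =
    1 - (p s(a, h) * p s(h, b) + p s(a, h) * p s(h, c) + p s(h, b) * p s(h, c)) +
      2 * (p s(a, h) * p s(h, b) * p s(h, c)) := by
  have e := PrW_pendant_Q p (star_disj hab hac hah) (star_sep hab hac) (star_avoids hab hac hah)
    (single_avoids hab.symm hbh) (single_avoids hac.symm hch) hab hac
  rw [Finset.empty_union, ← Finset.insert_eq] at e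
  rw [e, single_armT p hah, twoArms_Q p hbc hbh hch, twoArms_U₁ p hbc hbh hch, twoArms_U₂ p hbc hbh hch]; ring

end Star

/-! ### Product events on disjoint coordinates: small generic tools -/

section Tools

omit [DecidableEq V] in
/-- The indicator of an event that factors as a conjunction is the product of the indicators. [folklore] -/
theorem ind_eq_mul_of_iff {β γ : Type*} {X : Set (Finset (Sym2 V))} {A : Set β} {B : Set γ} {x : Finset (Sym2 V)}
    {y : β} {z : γ} (h : x ∈ X ↔ (y ∈ A ∧ z ∈ B)) : ind X x = ind A y * ind B z := by
  by_cases hx : x ∈ X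
  · obtain ⟨ha, hb⟩ := h.1 hx
    rw [ind_of_mem hx, ind_of_mem ha, ind_of_mem hb, mul_one]
  · by_cases ha : y ∈ A
    · have hb : z ∉ B := fun hb => hx (h.2 ⟨ha, hb⟩)
      rw [ind_of_not_mem hx, ind_of_mem ha, ind_of_not_mem hb, mul_zero]
    · rw [ind_of_not_mem hx, ind_of_not_mem ha, zero_mul]

/-- A coordinate outside the second block is read off the first block. [folklore] -/
theorem mem_union_iff_left {S₁ S₂ D₂ : Finset (Sym2 V)} {e : Sym2 V} (h₂ : S₂ ⊆ D₂) (he : e ∉ D₂) :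
    e ∈ S₁ ∪ S₂ ↔ e ∈ S₁ := by
  rw [Finset.mem_union]
  exact ⟨fun h => h.resolve_right (fun h' => he (h₂ h')), Or.inl⟩

/-- A coordinate outside the first block is read off the second block. [folklore] -/
theorem mem_union_iff_right {S₁ S₂ D₁ : Finset (Sym2 V)} {e : Sym2 V} (h₁ : S₁ ⊆ D₁) (he : e ∉ D₁) :
    e ∈ S₁ ∪ S₂ ↔ e ∈ S₂ := by
  rw [Finset.mem_union]
  exact ⟨fun h => h.resolve_left (fun h' => he (h₁ h')), Or.inr⟩

variable (p : Sym2 V → ℝ)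

/-- Complementary events: `PrW {¬P} = 1 − PrW {P}`. [folklore] -/
theorem PrW_not (D : Finset (Sym2 V)) (P : Finset (Sym2 V) → Prop) :
    PrW D p {S | ¬ P S} = 1 - PrW D p {S | P S} := by
  have h := PrW_of_ind_add D p (A := Set.univ) (B := {S | P S}) (C := {S | ¬ P S}) (fun S _ => by
    rw [ind_of_mem (Set.mem_univ S)]
    by_cases hP : P S
    · rw [ind_of_mem (show S ∈ {S | P S} from hP), ind_of_not_mem (show S ∉ {S | ¬ P S} from fun h => h hP)]; ring
    · rw [ind_of_not_mem (show S ∉ {S | P S} from hP), ind_of_mem (show S ∈ {S | ¬ P S} from hP)]; ring)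
  rw [PrW_univ] at h
  linarith

/-- One coordinate: `PrW {e} {e open} = p_e`. [folklore] -/
theorem PrW_single_mem (e : Sym2 V) : PrW ({e} : Finset (Sym2 V)) p {S | e ∈ S} = p e := by
  rw [← Finset.insert_empty, PrW_split ∅ p (Finset.notMem_empty _), CubicFourPointL1.PrW_empty, CubicFourPointL1.PrW_empty,
    ind_of_not_mem (show (∅ : Finset (Sym2 V)) ∉ {S : Finset (Sym2 V) | e ∈ S} from Finset.notMem_empty e),
    ind_of_mem (show (∅ : Finset (Sym2 V)) ∈ {S : Finset (Sym2 V) | insert e S ∈ {S : Finset (Sym2 V) | e ∈ S}} from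
      Finset.mem_insert_self e ∅)]
  ring

/-- Two coordinates: `PrW {e,e'} {e open ∨ e' open} = p_e + p_{e'} − p_e p_{e'}` (a doubled arm). [folklore] -/
theorem PrW_pair_or {e e' : Sym2 V} (hne : e ≠ e') :
    PrW ({e, e'} : Finset (Sym2 V)) p {S | e ∈ S ∨ e' ∈ S} = p e + p e' - p e * p e' := by
  have he : e ∉ ({e'} : Finset (Sym2 V)) := fun h => hne (Finset.mem_singleton.1 h)
  rw [show ({e, e'} : Finset (Sym2 V)) = insert e {e'} from rfl, PrW_split _ p he,
    PrW_eq_one_of_forall _ p (A := {S : Finset (Sym2 V) | insert e S ∈ {S : Finset (Sym2 V) | e ∈ S ∨ e' ∈ S}})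
      (fun S _ => Or.inl (Finset.mem_insert_self e S)),
    PrW_of_ind_eq _ p (A := {S : Finset (Sym2 V) | e ∈ S ∨ e' ∈ S}) (B := {S : Finset (Sym2 V) | e' ∈ S}) (fun S hS => by
      have : (S ∈ {S : Finset (Sym2 V) | e ∈ S ∨ e' ∈ S}) ↔ S ∈ {S : Finset (Sym2 V) | e' ∈ S} := by
        simp only [Set.mem_setOf_eq]
        exact ⟨fun h => h.resolve_left (fun h' => he (hS h')), Or.inr⟩
      by_cases hm : S ∈ {S : Finset (Sym2 V) | e' ∈ S}
      · rw [ind_of_mem hm, ind_of_mem (this.2 hm)]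
      · rw [ind_of_not_mem hm, ind_of_not_mem (fun h => hm (this.1 h))]),
    PrW_single_mem p e']
  ring

end Tools

end ThetaCells

end Summit.CriticalPhenomena.PercolationContinuityZ3.Theorems

end
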